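import Summits.QuantumFields.YangMills.Theorems.UnitScaleTiltFluctuationComparisonRegPrLiftFaceKernel

/-!
# Route `UnitScaleTilt` — crux K1bR-pr `FluctuationComparisonRegPr` (stmt-QuantumFields-19201), stub `stub_oneStepSmallLift`
# (W7 line), piece (L2), layer F5a: TRANSPORT UNIFICATION (lattice Stokes) and the EXPONENTIAL LINEARISATION of the twisted coboundary of
# the kernel lift (support file `--supports stmt-QuantumFields-19201`)

Fleet seat `ym-ust-19201-p1` gen 2 (CARD-19201-oneStepSmallLift-L1L2 §2 (L2-ii)–(L2-iii)).  Two generic second-order tools for the plaquette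
clause of the kernel lift `U⋆_V = exp(ζ_V) · faceSec V` (`…LiftFaceKernel`), in any gauge (no local axial gauge is fixed — the «twists» are
bounded directly):

* §1 conjugation bookkeeping (`conjM_one/_mul`, `‖Ad_g X − X‖ ≤ 2‖g − 1‖‖X‖`) and **TRANSPORT UNIFICATION**: two coarse transports from `y`
  along words `ω, ω′` with the same end point conjugate a matrix `X` to within `2·((|ω|+|ω′|)²/4)·δ·‖X‖` of each other on a `δ`-small `V`
  (`norm_conjM_holAt_sub_le`) — the discrepancy is the holonomy of the closed word `ω ++ ω′⁻¹`, bounded by the tree's lattice Stokes theorem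
  `LatticeWordStokes.dist1_holAt_le`.
* §2 **EXPONENTIAL LINEARISATION**: on small fields `‖E(b) − 1 − ζ(b)‖ ≤ ‖ζ(b)‖²`, `E(b)⁻¹ = exp(−ζ(b))`, `‖E(b)⁻¹ − 1 + ζ(b)‖ ≤ ‖ζ(b)‖²`, and
  for the twisted coboundary of layer F3: `‖linCobd E W p − lin₁‖ ≤ 4s²` with the LINEAR TWISTED COBOUNDARY
  `lin₁ = ζ₁ + Ad_{W₁}ζ₂ − Ad_{W₁W₂W₃⁻¹}ζ₃ − Ad_{W(∂p)}ζ₄` (`norm_linCobd_sub_linZeta_le`), `‖ζ_k‖ ≤ s ≤ 1`.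

Elementary; nothing of Bałaban's is asserted.
-/

noncomputable section

open scoped BigOperators Matrix.Norms.L2Operator
open NormedSpace

namespace Summit.QuantumFields.YangMills.Theorems.ApproxLift

open Literature.MathematicalPhysics.QuantumFieldTheory.Balaban1983to89
open T4Continuum BlockAveraging AveragingRT B10Eq47AxialChi BlockAveragingSection BlockAveragingSectionPlaq ExpMeanLog MatrixLog

variable {P : Params} {j : ℕ} {n : Type*} [Fintype n] [DecidableEq n] [Nonempty n]

/-! ## §1 Conjugation and transport unification -/

/-- In the model, `dist1 g = ‖g − 1‖`. -/
private theorem dist1_su_eq₃ (g : Matrix.specialUnitaryGroup n ℂ) : dist1 g = ‖(g : Matrix n n ℂ) - 1‖ := rfl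

/-- A special unitary matrix has operator norm `≤ 1`. -/
private theorem norm_coe_su_le_one₃ (g : Matrix.specialUnitaryGroup n ℂ) : ‖(g : Matrix n n ℂ)‖ ≤ 1 :=
  (UnitaryModel.norm_of_mem_unitaryGroup (Matrix.specialUnitaryGroup_le_unitaryGroup g.2)).le

omit [Nonempty n] in
/-- `Ad_1 = id`. -/
theorem conjM_one (X : Matrix n n ℂ) : conjM (1 : Matrix.specialUnitaryGroup n ℂ) X = X := by
  unfold conjM; rw [inv_one]; show (1 : Matrix n n ℂ) * X * 1 = X; rw [one_mul, mul_one]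

omit [Nonempty n] in
/-- `Ad_{gh} = Ad_g ∘ Ad_h`. -/
theorem conjM_mul (g h : Matrix.specialUnitaryGroup n ℂ) (X : Matrix n n ℂ) : conjM (g * h) X = conjM g (conjM h X) := by
  unfold conjM
  rw [mul_inv_rev, Submonoid.coe_mul, Submonoid.coe_mul]
  noncomm_ring

omit [Nonempty n] in
/-- `Ad` is additive. -/
theorem conjM_add (g : Matrix.specialUnitaryGroup n ℂ) (X Y : Matrix n n ℂ) : conjM g (X + Y) = conjM g X + conjM g Y := by
  unfold conjM; noncomm_ring

omit [Nonempty n] in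
/-- `Ad` commutes with subtraction. -/
theorem conjM_sub (g : Matrix.specialUnitaryGroup n ℂ) (X Y : Matrix n n ℂ) : conjM g (X - Y) = conjM g X - conjM g Y := by
  unfold conjM; noncomm_ring

omit [Nonempty n] in
/-- `Ad` is `ℂ`-homogeneous. -/
theorem conjM_smul (g : Matrix.specialUnitaryGroup n ℂ) (a : ℂ) (X : Matrix n n ℂ) : conjM g (a • X) = a • conjM g X := by
  unfold conjM; rw [Matrix.mul_smul, Matrix.smul_mul]

omit [Nonempty n] in
/-- `Ad` of a finite sum. -/
theorem conjM_sum {ι : Type*} (S : Finset ι) (g : Matrix.specialUnitaryGroup n ℂ) (X : ι → Matrix n n ℂ) :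
    conjM g (∑ i ∈ S, X i) = ∑ i ∈ S, conjM g (X i) := by
  unfold conjM; rw [Finset.mul_sum, Finset.sum_mul]

/-- **`‖Ad_g X − X‖ ≤ 2‖g − 1‖‖X‖`**. -/
theorem norm_conjM_sub_self_le (g : Matrix.specialUnitaryGroup n ℂ) (X : Matrix n n ℂ) :
    ‖conjM g X - X‖ ≤ 2 * dist1 g * ‖X‖ := by
  have hinv : dist1 g⁻¹ = dist1 g := GaugeGroup.dist1_inv g
  rw [dist1_su_eq₃, dist1_su_eq₃] at hinv
  rw [dist1_su_eq₃]
  have h : conjM g X - X = ((g : Matrix n n ℂ) - 1) * X * ((g⁻¹ : Matrix.specialUnitaryGroup n ℂ) : Matrix n n ℂ) +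
      X * (((g⁻¹ : Matrix.specialUnitaryGroup n ℂ) : Matrix n n ℂ) - 1) := by
    unfold conjM; noncomm_ring
  rw [h]
  calc _ ≤ ‖((g : Matrix n n ℂ) - 1) * X * ((g⁻¹ : Matrix.specialUnitaryGroup n ℂ) : Matrix n n ℂ)‖ +
        ‖X * (((g⁻¹ : Matrix.specialUnitaryGroup n ℂ) : Matrix n n ℂ) - 1)‖ := norm_add_le _ _
    _ ≤ ‖(g : Matrix n n ℂ) - 1‖ * ‖X‖ * 1 + ‖X‖ * ‖(g : Matrix n n ℂ) - 1‖ := by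
        refine add_le_add ?_ ?_
        · exact (norm_mul_le _ _).trans (mul_le_mul (norm_mul_le _ _) (norm_coe_su_le_one₃ _) (norm_nonneg _) (by positivity))
        · exact (norm_mul_le _ _).trans (by rw [hinv])
    _ = 2 * ‖(g : Matrix n n ℂ) - 1‖ * ‖X‖ := by ring

/-- **`‖Ad_g X − Ad_h X‖ ≤ 2‖gh⁻¹ − 1‖‖X‖`**. -/
theorem norm_conjM_sub_conjM_le (g h : Matrix.specialUnitaryGroup n ℂ) (X : Matrix n n ℂ) :
    ‖conjM g X - conjM h X‖ ≤ 2 * dist1 (g * h⁻¹) * ‖X‖ := by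
  have h1 : conjM g X = conjM (g * h⁻¹) (conjM h X) := by rw [← conjM_mul, inv_mul_cancel_right]
  rw [h1]
  exact (norm_conjM_sub_self_le _ _).trans
    (mul_le_mul_of_nonneg_left (norm_conjM_le _ _) (by have := GaugeGroup.dist1_nonneg (g * h⁻¹); positivity))

/-- Words with the same INTEGER net displacement end at the same site. -/
theorem walkEnd_eq_of_netDisp_eq (y : Site P (j + 1)) {ω ω' : List (Letter P.d)} (h : ∀ ν, netDisp ω ν = netDisp ω' ν) :
    walkEnd y ω = walkEnd y ω' := by
  funext ν; rw [walkEnd_apply, walkEnd_apply, h ν]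

/-- **TWO TRANSPORTS ALONG HOMOTOPIC WORDS DIFFER BY A SMALL CLOSED HOLONOMY** (lattice Stokes): for words `ω, ω′` from `y` with the same
INTEGER net displacement (so `ω ++ ω′⁻¹` is null-homotopic, not merely closed on the torus) and a `δ`-small `V`,
`dist1 (V(ω) · V(ω′)⁻¹) ≤ ((|ω| + |ω′|)²/4)·δ`. -/
theorem dist1_holAt_mul_inv_le {G : Type*} [GaugeGroup G] {δ : ℝ} (hδ : 0 ≤ δ) {V : GaugeField P (j + 1) G} (hV : PlaqSmall δ V)
    (y : Site P (j + 1)) (ω ω' : List (Letter P.d)) (h : ∀ ν, netDisp ω ν = netDisp ω' ν) :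
    dist1 (holAt V (walk y ω) * (holAt V (walk y ω'))⁻¹) ≤ (((ω.length + ω'.length : ℕ) : ℝ) ^ 2 / 4) * δ := by
  have hprod : holAt V (walk y ω) * (holAt V (walk y ω'))⁻¹ = holAt V (walk y (ω ++ wordRev ω')) := by
    rw [walk_append, holAt_append, walkEnd_eq_of_netDisp_eq y h, holAt_walk_wordRev]
  have hclosed : ∀ ν, netDisp (ω ++ wordRev ω') ν = 0 := fun ν => by
    rw [T4ReflectionCone.netDisp_append, netDisp_wordRev, h ν, add_neg_cancel]
  rw [hprod]
  have hlen : (ω ++ wordRev ω').length = ω.length + ω'.length := by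
    unfold wordRev; rw [List.length_append, List.length_reverse, List.length_map]
  have := LatticeWordStokes.dist1_holAt_le V hδ hV (ω ++ wordRev ω') hclosed y
  rw [hlen] at this
  exact this

/-- **TRANSPORT UNIFICATION**: conjugating `X` by the transports of a `δ`-small `V` along two words with the same integer net displacement
gives results within `2·((|ω| + |ω′|)²/4)·δ·‖X‖` of each other. -/
theorem norm_conjM_holAt_sub_le {δ : ℝ} (hδ : 0 ≤ δ) {V : GaugeField P (j + 1) (Matrix.specialUnitaryGroup n ℂ)} (hV : PlaqSmall δ V)
    (y : Site P (j + 1)) (ω ω' : List (Letter P.d)) (h : ∀ ν, netDisp ω ν = netDisp ω' ν) (X : Matrix n n ℂ) :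
    ‖conjM (holAt V (walk y ω)) X - conjM (holAt V (walk y ω')) X‖ ≤
      2 * ((((ω.length + ω'.length : ℕ) : ℝ) ^ 2 / 4) * δ) * ‖X‖ :=
  (norm_conjM_sub_conjM_le _ _ X).trans
    (mul_le_mul_of_nonneg_right (mul_le_mul_of_nonneg_left (dist1_holAt_mul_inv_le hδ hV y ω ω' h) (by norm_num)) (norm_nonneg _))

/-! ## §2 Exponential linearisation of the correction and of the twisted coboundary -/

section ExpLin

variable {R : ℕ} {kz : Fin P.d → (Fin P.d → Fin P.L) → Orient P.d → (Fin P.d → Fin (2 * R + 1)) → ℝ}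

/-- `‖E(b) − 1 − ζ(b)‖ ≤ ‖ζ(b)‖²` on small fields (`‖ζ(b)‖ ≤ 1`). -/
theorem norm_coe_corrE_sub_one_sub_zeta_le {δ : ℝ} {V : GaugeField P (j + 1) (Matrix.specialUnitaryGroup n ℂ)} (hV : PlaqSmall δ V)
    (hδ : δ ≤ 1 / 3) (hπ : Fintype.card n * δ < Real.pi) {b : PBond P j} (h1 : ‖zeta R kz V b‖ ≤ 1) :
    ‖((corrE R kz V b : Matrix.specialUnitaryGroup n ℂ) : Matrix n n ℂ) - 1 - zeta R kz V b‖ ≤ ‖zeta R kz V b‖ ^ 2 := by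
  rw [coe_corrE hV hδ hπ]
  letI : NormedAlgebra ℝ (Matrix n n ℂ) := NormedAlgebra.restrictScalars ℝ ℂ (Matrix n n ℂ)
  exact Literature.MathematicalPhysics.QuantumFieldTheory.OneLinkLaplace.norm_exp_sub_one_sub_le_sq h1

/-- `E(b)⁻¹ = exp(−ζ(b))` on small fields (`ζ` is skew-Hermitian). -/
theorem coe_corrE_inv {δ : ℝ} {V : GaugeField P (j + 1) (Matrix.specialUnitaryGroup n ℂ)} (hV : PlaqSmall δ V)
    (hδ : δ ≤ 1 / 3) (hπ : Fintype.card n * δ < Real.pi) (b : PBond P j) :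
    (((corrE R kz V b)⁻¹ : Matrix.specialUnitaryGroup n ℂ) : Matrix n n ℂ) = exp (-zeta R kz V b) := by
  have hinv : (((corrE R kz V b)⁻¹ : Matrix.specialUnitaryGroup n ℂ) : Matrix n n ℂ) =
      star ((corrE R kz V b : Matrix.specialUnitaryGroup n ℂ) : Matrix n n ℂ) := rfl
  have hs := (zeta_mem (R := R) (kz := kz) hV hδ hπ b).1
  rw [skewAdjoint.mem_iff] at hs
  rw [hinv, coe_corrE hV hδ hπ, star_exp, hs]

/-- `‖E(b)⁻¹ − 1 + ζ(b)‖ ≤ ‖ζ(b)‖²` on small fields (`‖ζ(b)‖ ≤ 1`). -/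
theorem norm_coe_corrE_inv_sub_one_add_zeta_le {δ : ℝ} {V : GaugeField P (j + 1) (Matrix.specialUnitaryGroup n ℂ)}
    (hV : PlaqSmall δ V) (hδ : δ ≤ 1 / 3) (hπ : Fintype.card n * δ < Real.pi) {b : PBond P j} (h1 : ‖zeta R kz V b‖ ≤ 1) :
    ‖(((corrE R kz V b)⁻¹ : Matrix.specialUnitaryGroup n ℂ) : Matrix n n ℂ) - 1 + zeta R kz V b‖ ≤ ‖zeta R kz V b‖ ^ 2 := by
  rw [coe_corrE_inv hV hδ hπ]
  letI : NormedAlgebra ℝ (Matrix n n ℂ) := NormedAlgebra.restrictScalars ℝ ℂ (Matrix n n ℂ)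
  have h := Literature.MathematicalPhysics.QuantumFieldTheory.OneLinkLaplace.norm_exp_sub_one_sub_le_sq (X := -zeta R kz V b)
    (by rwa [norm_neg])
  rw [sub_neg_eq_add, norm_neg] at h
  exact h

/-- THE LINEAR TWISTED COBOUNDARY of the correction around `p` with the transports of `W`:
`ζ₁ + Ad_{W₁}ζ₂ − Ad_{W₁W₂W₃⁻¹}ζ₃ − Ad_{W(∂p)}ζ₄`. -/
def linZeta (R : ℕ) (kz : Fin P.d → (Fin P.d → Fin P.L) → Orient P.d → (Fin P.d → Fin (2 * R + 1)) → ℝ)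
    (V : GaugeField P (j + 1) (Matrix.specialUnitaryGroup n ℂ)) (W : GaugeField P j (Matrix.specialUnitaryGroup n ℂ))
    (p : Plaq P j) : Matrix n n ℂ :=
  zeta R kz V ⟨p.src, p.μ⟩ + conjM (W ⟨p.src, p.μ⟩) (zeta R kz V ⟨p.src.shift p.μ, p.ν⟩) -
    conjM (W ⟨p.src, p.μ⟩ * W ⟨p.src.shift p.μ, p.ν⟩ * (W ⟨p.src.shift p.ν, p.μ⟩)⁻¹) (zeta R kz V ⟨p.src.shift p.ν, p.μ⟩) -
    conjM (GaugeField.plaqHol W p) (zeta R kz V ⟨p.src, p.ν⟩)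

/-- **THE TWISTED COBOUNDARY OF THE KERNEL CORRECTION IS ITS LINEAR TWISTED COBOUNDARY TO SECOND ORDER**: on small fields with
`‖ζ(b)‖ ≤ s ≤ 1` on the four bonds of `∂p`, `‖linCobd E W p − linZeta p‖ ≤ 4s²`. -/
theorem norm_linCobd_sub_linZeta_le {δ s : ℝ} {V : GaugeField P (j + 1) (Matrix.specialUnitaryGroup n ℂ)} (hV : PlaqSmall δ V)
    (hδ : δ ≤ 1 / 3) (hπ : Fintype.card n * δ < Real.pi) (W : GaugeField P j (Matrix.specialUnitaryGroup n ℂ)) (p : Plaq P j)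
    (hs : ∀ b, ‖zeta R kz V b‖ ≤ s) (hs1 : s ≤ 1) :
    ‖linCobd (corrE R kz V) W p - linZeta R kz V W p‖ ≤ 4 * s ^ 2 := by
  have h1 : ∀ b, ‖zeta R kz V b‖ ≤ 1 := fun b => (hs b).trans hs1
  set E := corrE R kz V with hE
  -- the four remainders
  set r₁ : Matrix n n ℂ := ((E ⟨p.src, p.μ⟩ : Matrix.specialUnitaryGroup n ℂ) : Matrix n n ℂ) - 1 - zeta R kz V ⟨p.src, p.μ⟩ with hr₁
  set r₂ : Matrix n n ℂ := ((E ⟨p.src.shift p.μ, p.ν⟩ : Matrix.specialUnitaryGroup n ℂ) : Matrix n n ℂ) - 1 -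
    zeta R kz V ⟨p.src.shift p.μ, p.ν⟩ with hr₂
  set r₃ : Matrix n n ℂ := (((E ⟨p.src.shift p.ν, p.μ⟩)⁻¹ : Matrix.specialUnitaryGroup n ℂ) : Matrix n n ℂ) - 1 +
    zeta R kz V ⟨p.src.shift p.ν, p.μ⟩ with hr₃
  set r₄ : Matrix n n ℂ := (((E ⟨p.src, p.ν⟩)⁻¹ : Matrix.specialUnitaryGroup n ℂ) : Matrix n n ℂ) - 1 + zeta R kz V ⟨p.src, p.ν⟩
    with hr₄
  have hb₁ : ‖r₁‖ ≤ s ^ 2 := (norm_coe_corrE_sub_one_sub_zeta_le hV hδ hπ (h1 _)).trans (by gcongr; exact hs _)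
  have hb₂ : ‖r₂‖ ≤ s ^ 2 := (norm_coe_corrE_sub_one_sub_zeta_le hV hδ hπ (h1 _)).trans (by gcongr; exact hs _)
  have hb₃ : ‖r₃‖ ≤ s ^ 2 := (norm_coe_corrE_inv_sub_one_add_zeta_le hV hδ hπ (h1 _)).trans (by gcongr; exact hs _)
  have hb₄ : ‖r₄‖ ≤ s ^ 2 := (norm_coe_corrE_inv_sub_one_add_zeta_le hV hδ hπ (h1 _)).trans (by gcongr; exact hs _)
  have hdiff : linCobd E W p - linZeta R kz V W p =
      r₁ + conjM (W ⟨p.src, p.μ⟩) r₂ + conjM (W ⟨p.src, p.μ⟩ * W ⟨p.src.shift p.μ, p.ν⟩ * (W ⟨p.src.shift p.ν, p.μ⟩)⁻¹) r₃ +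
        conjM (GaugeField.plaqHol W p) r₄ := by
    simp only [linCobd, linZeta, hr₁, hr₂, hr₃, hr₄]
    unfold conjM
    noncomm_ring
  rw [hdiff]
  calc _ ≤ ‖r₁‖ + ‖conjM (W ⟨p.src, p.μ⟩) r₂‖ +
        ‖conjM (W ⟨p.src, p.μ⟩ * W ⟨p.src.shift p.μ, p.ν⟩ * (W ⟨p.src.shift p.ν, p.μ⟩)⁻¹) r₃‖ +
        ‖conjM (GaugeField.plaqHol W p) r₄‖ :=
        (norm_add_le _ _).trans (add_le_add ((norm_add_le _ _).trans (add_le_add (norm_add_le _ _) le_rfl)) le_rfl)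
    _ ≤ s ^ 2 + s ^ 2 + s ^ 2 + s ^ 2 := by
        gcongr
        · exact (norm_conjM_le _ _).trans hb₂
        · exact (norm_conjM_le _ _).trans hb₃
        · exact (norm_conjM_le _ _).trans hb₄
    _ = 4 * s ^ 2 := by ring

end ExpLin

end Summit.QuantumFields.YangMills.Theorems.ApproxLift

end
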